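import Mathlib
import HarnessLib
import Summits.HubbardSuperconductivity.HubbardSuperconductivity.Theorems.KLProgrammeC4aJetComparisonSharp
import Summits.HubbardSuperconductivity.HubbardSuperconductivity.Theorems.KLProgrammeC4aPathJetsSix
import Summits.HubbardSuperconductivity.HubbardSuperconductivity.Theorems.KLProgrammeC4aValueBridgeGeometry
import Summits.HubbardSuperconductivity.HubbardSuperconductivity.Theorems.KLProgrammeC4aLoopIBPJets
import Summits.HubbardSuperconductivity.HubbardSuperconductivity.Theorems.KLProgrammeC4aLevelChart
import Summits.HubbardSuperconductivity.HubbardSuperconductivity.Theorems.KLProgrammeC4aRadialRowsTwoThree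
import Summits.HubbardSuperconductivity.HubbardSuperconductivity.Theorems.KLProgrammePerturbedFermiCurveTowerSixStep

/-!
# Route `KLProgramme` — crux C4a, S3 brick (B2, RADIAL ROWS AT EVERY ORDER): the angular jets of the co-moving chart are Lipschitz in the
# LEVEL, `‖Φ_x⁽ⁱ⁾(s) − Φ_0⁽ⁱ⁾(s)‖ ≤ RRᵢ·|x|` for every `i ≤ 5`, by the line device (no order-by-order formulas)

Cell `gate-hubbard-kl`, seat hubbard-kl-k3c3-p3 (g23; row «implicit-function / monotonicity route»).  Located brick «(B2)-TAN-ALL», part 2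
«(B2)-RADIAL-ALL», for the (C)-closer lane hubbard-kl-c4a-1 (stub (C) `stub_twoLeg_curvature` of `KLRegimeEngineV17F2`,
stmt-HubbardSuperconductivity-20437; memo HOME/hubbard-kl-c4a-1/C4A-PLAN.md §24.8/§24.9 «orders 3–4 at (T)»: the order-`k` reductions of
`…C4aPartnerBandTangencyDefectSharp` need the radial rows `RRᵢ`, `i ≤ k`; rows `0…3` are `…C4aRadialRowOne` / `…C4aRadialRowsTwoThree`
(explicit formulas); this file gives EVERY row `i ≤ 5` at once and in particular `RR₄`, which makes order `4` unconditional).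

THE DEVICE.  `g(ρ) := ∂ᵢ_ϑ Φ(ρ,·)(s)` is differentiable in the LEVEL with `g′(ρ) = ∂ᵢ_ϑ V(ρ,·)(s)`, `V(ρ,ϑ) := ∂_ρΦ(ρ,ϑ)` the level velocity
(`∂_ρ∂ᵢ_ϑ = ∂ᵢ_ϑ∂_ρ`: §1, a generic lemma for a jointly smooth map on the open strip `{|ρ| < r}`, through a smooth cut-off in the level
(`ContDiffBump`) and the line calculus of `…C4aTangencyCalculusAll` / `…C4aJetComparisonSharp` — `D^{i+1}P̃[w, vⁱ] = ∂ᵢ_t (∂_wP̃)` — so no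
symmetry of `iteratedFDeriv` beyond the landed Clairaut swap is used).  The velocity is `V(ρ,ϑ) = D(ρ,ϑ)⁻¹ • toLp(dir ϑ)` with the RADIAL SLOPE
`D(ρ,ϑ) = De_K(Φ(ρ,ϑ))[toLp dir ϑ] ≥ Dt_min − 2A` (`hasDerivAt_levelPoint_level`, `radialSlope_momentum_ge`); the slope's angular jets obey
`|∂ˡ_ϑ D| ≤ (l+1)!·𝒦·𝒟ˡ` (`norm_iteratedDeriv_fderiv_comp_apply_le`), the reciprocal's jets a table `Q` (`abs_iteratedDeriv_inv_le_of_table`), and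
the mean value theorem in the level gives the rows.

* §1 `contDiff_bump_smul_of_strip`, `hasDerivAt_iteratedDeriv_level_of_strip`, `norm_iteratedDeriv_sub_le_of_strip` (generic: curried
  `Ψ : ℝ → ℝ → F` jointly `C^{i+1}` on the strip, partial level derivative `V`);
* §2 `fderiv_frameLevel_eq_of_level`, `radialSlope_levelPoint_ge`, `deriv_levelRadius_level_eq_inv_slope`, `hasDerivAt_levelPoint_level_slope`,
  `abs_iteratedDeriv_radialSlope_le`, `abs_iteratedDeriv_inv_radialSlope_le`, `norm_iteratedDeriv_levelVel_le`;
* §3 **`norm_iteratedDeriv_levelPoint_sub_le_of_table`** — `‖Φ_x⁽ⁱ⁾(s) − Φ_0⁽ⁱ⁾(s)‖ ≤ (Σ_{j≤i} C(i,j)·Q j)·|x|` for `i ≤ N ≤ 5`, `|x| < r`, whenever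
  `‖Dᵐe_K‖ ≤ 𝒦` (`1 ≤ m ≤ N+1`), `1 ≤ 𝒟`, `msD6 j ≤ 𝒟ʲ` (`1 ≤ j ≤ N`) and `Q` closes the reciprocal recursion
  `d⁻¹ ≤ Q 0`, `d⁻¹·Σ_{j<k} C(k,j)·Q j·(k−j+1)!·𝒦·𝒟^{k−j} ≤ Q k` (`d = Dt_min − 2A`).

Proved bookkeeping on landed objects; nothing about the Hubbard model's sizes; nothing asserts superconductivity.
References: BGM 2006 §2.4 Lemma 2.1 (2.40)–(2.41) [cite: BenfattoGiulianiMastropietro2006]; FST II CPAM 51 (1998) §3.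
-/

noncomputable section

namespace Summit.HubbardSuperconductivity.HubbardSuperconductivity.Theorems.C4a

set_option linter.dupNamespace false -- summit = problem name (single-conjunct summit), D-0017

open Real Set Filter Finset
open scoped Topology
open Literature.MathematicalPhysics.QuantumLattice Literature.MathematicalPhysics.QuantumLattice.BandSectorCounting Literature.Probability.LatticeModels
open Summit.HubbardSuperconductivity.HubbardSuperconductivity.Theorems.KLRegimeSplit
open Summit.HubbardSuperconductivity.HubbardSuperconductivity.Theorems.DispersionFlow
open Summit.HubbardSuperconductivity.HubbardSuperconductivity.Theorems.PerturbedFermiCurve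

/-! ## §1 Generic: on an open strip, the level derivative of an angular jet is the angular jet of the level velocity -/

section Strip

variable {F : Type*} [NormedAddCommGroup F] [NormedSpace ℝ F]

/-- A smooth cut-off in the first variable of a map that is `Cⁿ` on the open strip `{|p.1| < r}` (and arbitrary outside) is globally `Cⁿ`
when the cut-off is supported inside the strip. -/
theorem contDiff_bump_smul_of_strip {P : ℝ × ℝ → F} {r : ℝ} {n : ℕ} (hP : ∀ p : ℝ × ℝ, |p.1| < r → ContDiffAt ℝ n P p)
    (χ : ContDiffBump (0 : ℝ)) (hχ : χ.rOut < r) : ContDiff ℝ n (fun p : ℝ × ℝ => χ p.1 • P p) := by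
  refine contDiff_iff_contDiffAt.2 fun p => ?_
  by_cases hp : |p.1| < r
  · exact (((χ.contDiff (n := ⊤)).of_le (by exact_mod_cast le_top)).contDiffAt.comp p contDiff_fst.contDiffAt).smul (hP p hp)
  · -- outside the strip the function vanishes near `p`
    have hopen : IsOpen {q : ℝ × ℝ | χ.rOut < |q.1|} := isOpen_lt continuous_const (continuous_abs.comp continuous_fst)
    have hmem : p ∈ {q : ℝ × ℝ | χ.rOut < |q.1|} := by simp only [mem_setOf_eq]; linarith [not_lt.1 hp]
    have hev : (fun q : ℝ × ℝ => χ q.1 • P q) =ᶠ[𝓝 p] fun _ => (0 : F) := by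
      filter_upwards [hopen.mem_nhds hmem] with q hq
      have hz : χ q.1 = 0 := χ.zero_of_le_dist (by rw [Real.dist_eq, sub_zero]; exact le_of_lt hq)
      rw [hz, zero_smul]
    exact (contDiffAt_const.congr_of_eventuallyEq hev)

/-- **`∂_ρ ∂ᵢ_ϑ Ψ = ∂ᵢ_ϑ ∂_ρ Ψ` on the open strip.**  Let `Ψ : ℝ → ℝ → F` be jointly `C^{i+1}` at every point of `{|ρ| < r} × ℝ` and let `V ρ ϑ`
be the level derivative of `ρ ↦ Ψ ρ ϑ` there.  Then `ρ ↦ ∂ᵢ_ϑ Ψ(ρ,·)(s)` has derivative `∂ᵢ_ϑ V(ρ,·)(s)` at every `|ρ| < r`. [folklore] -/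
theorem hasDerivAt_iteratedDeriv_level_of_strip {Ψ V : ℝ → ℝ → F} {r : ℝ} {i : ℕ}
    (hP : ∀ p : ℝ × ℝ, |p.1| < r → ContDiffAt ℝ (i + 1 : ℕ) (fun q : ℝ × ℝ => Ψ q.1 q.2) p)
    (hV : ∀ ρ, |ρ| < r → ∀ ϑ, HasDerivAt (fun x : ℝ => Ψ x ϑ) (V ρ ϑ) ρ) {ρ₀ : ℝ} (hρ₀ : |ρ₀| < r) (s : ℝ) :
    HasDerivAt (fun ρ : ℝ => iteratedDeriv i (Ψ ρ) s) (iteratedDeriv i (V ρ₀) s) ρ₀ := by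
  have hr : 0 < r := lt_of_le_of_lt (abs_nonneg ρ₀) hρ₀
  -- the cut-off: `= 1` on `|ρ| ≤ rIn`, `= 0` on `|ρ| ≥ rOut`, `|ρ₀| < rIn < rOut < r`
  set χ : ContDiffBump (0 : ℝ) := ⟨(|ρ₀| + r) / 2, (|ρ₀| + 3 * r) / 4, by positivity, by linarith⟩ with hχ
  have hχin : χ.rIn = (|ρ₀| + r) / 2 := rfl
  have hχout : χ.rOut = (|ρ₀| + 3 * r) / 4 := rfl
  have hχr : χ.rOut < r := by rw [hχout]; linarith
  set P : ℝ × ℝ → F := fun q => Ψ q.1 q.2 with hPdef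
  set Pt : ℝ × ℝ → F := fun q => χ q.1 • P q with hPt
  have hPtc : ContDiff ℝ (i + 1 : ℕ) Pt := contDiff_bump_smul_of_strip hP χ hχr
  -- on the inner strip the cut-off is `1`
  have hone : ∀ ρ : ℝ, |ρ| < χ.rIn → ∀ ϑ, Pt (ρ, ϑ) = Ψ ρ ϑ := fun ρ hρ ϑ => by
    have h1 : χ ρ = 1 := χ.one_of_mem_closedBall (by rw [Metric.mem_closedBall, Real.dist_eq, sub_zero]; exact hρ.le)
    simp only [hPt, hPdef, h1, one_smul]
  have hin_open : IsOpen {ρ : ℝ | |ρ| < χ.rIn} := isOpen_lt continuous_abs continuous_const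
  have hρ₀in : |ρ₀| < χ.rIn := by rw [hχin]; linarith
  set q : ℝ × ℝ := (0, s) with hq
  set v : ℝ × ℝ := (0, 1) with hv
  set w : ℝ × ℝ := (1, 0) with hw
  have hline : ∀ ρ t : ℝ, q + ρ • w + t • v = (ρ, s + t) := fun ρ t => by
    rw [hq, hv, hw]; refine Prod.ext ?_ ?_ <;> simp
  have hline0 : ∀ ρ : ℝ, q + ρ • w = (ρ, s) := fun ρ => by have h := hline ρ 0; rwa [zero_smul, add_zero, add_zero] at h
  have hiN : ((i : ℕ) : WithTop ℕ∞) ≤ (i + 1 : ℕ) := by exact_mod_cast Nat.le_succ i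
  -- (1) near `ρ₀`, the angular jet is the line jet of `Pt`
  have hG : (fun ρ : ℝ => iteratedDeriv i (Ψ ρ) s) =ᶠ[𝓝 ρ₀] fun ρ : ℝ => iteratedFDeriv ℝ i Pt (q + ρ • w) (fun _ => v) := by
    filter_upwards [hin_open.mem_nhds hρ₀in] with ρ hρ
    have hcl := iteratedDeriv_comp_line Pt hPtc hiN (q + ρ • w) v 0
    rw [zero_smul, add_zero] at hcl
    rw [← hcl]
    have hfun : (fun t : ℝ => Pt (q + ρ • w + t • v)) = fun t : ℝ => Ψ ρ (s + t) := by
      funext t; rw [hline ρ t, hone ρ hρ]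
    rw [hfun, iteratedDeriv_comp_const_add i (Ψ ρ) s]
    simp only [add_zero]
  -- (2) the line jet is differentiable in `ρ` with derivative `D^{i+1}Pt[w, vⁱ]`
  have hG' : HasDerivAt (fun ρ : ℝ => iteratedFDeriv ℝ i Pt (q + ρ • w) (fun _ => v))
      (iteratedFDeriv ℝ (i + 1) Pt (q + ρ₀ • w) (Fin.cons w fun _ => v)) ρ₀ := hasDerivAt_iteratedFDeriv_line hPtc le_rfl q w _ ρ₀
  -- (3) `D^{i+1}Pt(ρ₀,s)[w, vⁱ] = ∂ᵢ_t (∂_w Pt)(ρ₀, s+t)|₀ = ∂ᵢ_ϑ V(ρ₀,·)(s)`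
  have hval : iteratedFDeriv ℝ (i + 1) Pt (q + ρ₀ • w) (Fin.cons w fun _ => v) = iteratedDeriv i (V ρ₀) s := by
    rw [iteratedFDeriv_cons_line_eq_iteratedDeriv_fderiv hPtc le_rfl (q + ρ₀ • w) v w]
    have hfd : ∀ t : ℝ, fderiv ℝ Pt (q + ρ₀ • w + t • v) w = V ρ₀ (s + t) := fun t => by
      rw [hline ρ₀ t]
      -- `Pt = P` near `(ρ₀, s+t)`
      have hev : Pt =ᶠ[𝓝 (ρ₀, s + t)] P := by
        have hopen : IsOpen {p : ℝ × ℝ | |p.1| < χ.rIn} := isOpen_lt (continuous_abs.comp continuous_fst) continuous_const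
        filter_upwards [hopen.mem_nhds (show (ρ₀, s + t) ∈ {p : ℝ × ℝ | |p.1| < χ.rIn} from hρ₀in)] with p hp
        have h1 : χ p.1 = 1 := χ.one_of_mem_closedBall (by rw [Metric.mem_closedBall, Real.dist_eq, sub_zero]; exact (le_of_lt hp))
        simp only [hPt, h1, one_smul]
      rw [hev.fderiv_eq]
      -- the partial derivative of `P` along `w` is `V`
      have hPd : DifferentiableAt ℝ P (ρ₀, s + t) := (hP (ρ₀, s + t) hρ₀).differentiableAt (by exact_mod_cast Nat.succ_ne_zero i)
      have hl : HasDerivAt (fun x : ℝ => ((ρ₀, s + t) : ℝ × ℝ) + x • w) w 0 := by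
        simpa using ((hasDerivAt_id (0 : ℝ)).smul_const w).const_add ((ρ₀, s + t) : ℝ × ℝ)
      have hcomp0 := hPd.hasFDerivAt.comp_hasDerivAt_of_eq (0 : ℝ) hl (by rw [zero_smul, add_zero])
      have hcomp : HasDerivAt (fun x : ℝ => Ψ (ρ₀ + x) (s + t)) (fderiv ℝ P (ρ₀, s + t) w) 0 := by
        refine hcomp0.congr_of_eventuallyEq (Eventually.of_forall fun x => ?_)
        simp [hw, hPdef]
      have hV' : HasDerivAt (fun x : ℝ => Ψ (ρ₀ + x) (s + t)) (V ρ₀ (s + t)) 0 :=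
        HasDerivAt.comp_const_add ρ₀ 0 (by rw [add_zero]; exact hV ρ₀ hρ₀ (s + t))
      exact hcomp.unique hV'
    rw [show (fun t : ℝ => fderiv ℝ Pt (q + ρ₀ • w + t • v) w) = fun t : ℝ => V ρ₀ (s + t) from funext hfd,
      iteratedDeriv_comp_const_add i (V ρ₀) s]
    simp only [add_zero]
  rw [hval] at hG'
  exact hG'.congr_of_eventuallyEq hG

/-- **Angular jets are Lipschitz in the level, with constant the sup of the velocity's angular jets**: under the hypotheses of
`hasDerivAt_iteratedDeriv_level_of_strip` and `‖∂ᵢ_ϑ V(ρ,·)(s)‖ ≤ C` for `|ρ| < r`:  `‖∂ᵢ_ϑΨ(x,·)(s) − ∂ᵢ_ϑΨ(0,·)(s)‖ ≤ C·|x|` (`|x| < r`). -/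
theorem norm_iteratedDeriv_sub_le_of_strip {Ψ V : ℝ → ℝ → F} {r : ℝ} {i : ℕ}
    (hP : ∀ p : ℝ × ℝ, |p.1| < r → ContDiffAt ℝ (i + 1 : ℕ) (fun q : ℝ × ℝ => Ψ q.1 q.2) p)
    (hV : ∀ ρ, |ρ| < r → ∀ ϑ, HasDerivAt (fun x : ℝ => Ψ x ϑ) (V ρ ϑ) ρ) (s : ℝ) {C : ℝ}
    (hC : ∀ ρ, |ρ| < r → ‖iteratedDeriv i (V ρ) s‖ ≤ C) {x : ℝ} (hx : |x| < r) :
    ‖iteratedDeriv i (Ψ x) s - iteratedDeriv i (Ψ 0) s‖ ≤ C * |x| := by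
  have hseg : ∀ ρ ∈ uIcc (0 : ℝ) x, |ρ| < r := fun ρ hρ => lt_of_le_of_lt (abs_le_abs_of_mem_uIcc_zero hρ) hx
  have h := (convex_uIcc (0 : ℝ) x).norm_image_sub_le_of_norm_hasDerivWithin_le (f := fun ρ : ℝ => iteratedDeriv i (Ψ ρ) s)
    (fun ρ hρ => (hasDerivAt_iteratedDeriv_level_of_strip hP hV (hseg ρ hρ) s).hasDerivWithinAt) (fun ρ hρ => hC ρ (hseg ρ hρ))
    left_mem_uIcc right_mem_uIcc
  rwa [sub_zero, Real.norm_eq_abs] at h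

end Strip

/-! ## §2 The radial slope, its reciprocal, and the level velocity of the chart -/

/-- The band's derivative does not see the level: `De_{K,ν} = De_{K,μ}`. -/
theorem fderiv_frameLevel_eq_of_level (ν μ : ℝ) (K : TrigPolyC4v) : fderiv ℝ (frameLevel ν K) = fderiv ℝ (frameLevel μ K) := by
  have h : frameLevel ν K = fun q => frameLevel μ K q + (μ - ν) := by
    funext q; simp only [frameLevel]; ring
  funext q; rw [h, fderiv_add_const]

section Sizes

variable {K : TrigPolyC4v} {A : ℝ} (hA : ∀ p : Momentum, ∀ j ≤ 2, ‖iteratedFDeriv ℝ j (frameShift K) p‖ ≤ A) (hA20 : A ≤ 1 / 20)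
  (hd : klCurveD ≤ (bandBounds (show (-4 : ℝ) < -1.1 by norm_num) (show (-1.1 : ℝ) ≤ -0.1 by norm_num)
    (show (-0.1 : ℝ) < 0 by norm_num)).Dtmin - 2 * A)
  {μ r : ℝ} (hr : 0 < r) (hlo : (-1.1 : ℝ) < μ - r - A) (hhi : μ + r + A < -0.1)
  {A₃ A₄ A₅ A₆ : ℝ} (hA₃ : ∀ p : Momentum, ‖iteratedFDeriv ℝ 3 (frameShift K) p‖ ≤ A₃)
  (hA₄ : ∀ p : Momentum, ‖iteratedFDeriv ℝ 4 (frameShift K) p‖ ≤ A₄)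
  (hA₅ : ∀ p : Momentum, ‖iteratedFDeriv ℝ 5 (frameShift K) p‖ ≤ A₅)
  (hA₆ : ∀ p : Momentum, ‖iteratedFDeriv ℝ 6 (frameShift K) p‖ ≤ A₆)
include hA hA20 hd hr hlo hhi hA₃ hA₄ hA₅ hA₆

omit hA20 hd hr hA₃ hA₄ hA₅ hA₆ in
/-- **The radial slope floor on the tube**: `Dt_min − 2A ≤ D(ρ,ϑ) := De_K(Φ(ρ,ϑ))[toLp dir ϑ]` for `|ρ| < r`. -/
theorem radialSlope_levelPoint_ge {ρ : ℝ} (hρ : |ρ| < r) (ϑ : ℝ) :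
    (bandBounds (show (-4 : ℝ) < -1.1 by norm_num) (show (-1.1 : ℝ) ≤ -0.1 by norm_num) (show (-0.1 : ℝ) < 0 by norm_num)).Dtmin - 2 * A ≤
      fderiv ℝ (frameLevel μ K) (levelPoint μ K ρ ϑ) (WithLp.toLp 2 (dir ϑ)) := by
  have h1 : (-1.1 : ℝ) ≤ μ + ρ - A := by have := (abs_lt.1 hρ).1; linarith
  have h2 : μ + ρ + A ≤ -0.1 := by have := (abs_lt.1 hρ).2; linarith
  have h := radialSlope_momentum_ge hA (ν := μ + ρ) h1 h2 ϑ
  rwa [fderiv_frameLevel_eq_of_level (μ + ρ) μ K, ← WithLp.toLp_smul, ← levelPoint_eq_toLp_smul_dir] at h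

omit hA20 hr hA₃ hA₄ hA₅ hA₆ in
/-- **`∂_μu = 1/D`**: the level derivative of the radius is the reciprocal of the radial slope `D(ρ,ϑ) = De_K(Φ(ρ,ϑ))[toLp dir ϑ]`. -/
theorem deriv_levelRadius_level_eq_inv_slope {ρ : ℝ} (hρ : |ρ| < r) (ϑ : ℝ) :
    deriv (fun m : ℝ => perturbedFermiRadius (fun k : Fin 2 → ℝ => -K.eval k) m ϑ) (μ + ρ) =
      (fderiv ℝ (frameLevel μ K) (levelPoint μ K ρ ϑ) (WithLp.toLp 2 (dir ϑ)))⁻¹ := by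
  set B₀ := bandBounds (show (-4 : ℝ) < -1.1 by norm_num) (show (-1.1 : ℝ) ≤ -0.1 by norm_num) (show (-0.1 : ℝ) < 0 by norm_num) with hB₀
  have hADt : 2 * A < B₀.Dtmin := by have := klCurveD_pos; linarith
  have hC : ContDiff ℝ ((⊤ : ℕ∞) : WithTop ℕ∞) (fun k : Fin 2 → ℝ => -K.eval k) := by
    rw [← frameShift_toLp_eq_neg_eval]; exact contDiff_frameShift_toLp K
  have hδ : ∀ k : Fin 2 → ℝ, (∀ i, |k i| ≤ π) → |(fun q : Fin 2 → ℝ => -K.eval q) k| ≤ A := fun k _ => by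
    simpa [frameShift_toLp] using abs_frameShift_toLp_le hA k
  have hκ : ∀ k : Fin 2 → ℝ, (∀ i, |k i| ≤ π) → ‖fderiv ℝ (fun q : Fin 2 → ℝ => -K.eval q) k‖ ≤ 2 * A := fun k _ => by
    rw [← frameShift_toLp_eq_neg_eval]; exact norm_fderiv_frameShift_toLp_le hA k
  have hD := hasDerivAt_perturbedFermiRadius_level B₀ hC (by simp) hδ hκ hADt (μ₀ := μ + ρ)
    (by have := (abs_lt.1 hρ).1; linarith) (by have := (abs_lt.1 hρ).2; linarith) ϑ
  rw [hD.deriv]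
  congr 1
  -- the bridge `∂_tε₀ + Dδ[dir] = De_K(Φ)[toLp dir]`
  set u : ℝ := perturbedFermiRadius (fun k : Fin 2 → ℝ => -K.eval k) (μ + ρ) ϑ with hu
  have hdiff : Differentiable ℝ (fun k : Fin 2 → ℝ => sqDispersion k + (fun p : Fin 2 → ℝ => -K.eval p) k) :=
    (contDiff_pertBandK K).differentiable (by norm_num)
  have hdδ : DifferentiableAt ℝ (fun k : Fin 2 → ℝ => -K.eval k) (u • dir ϑ) := (hC.differentiable (by simp)) _
  have h1 : HasDerivAt (fun s : ℝ => rayDispersion (ϑ, s) + (fun k : Fin 2 → ℝ => -K.eval k) (s • dir ϑ))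
      (rayDispersionDt ϑ u + fderiv ℝ (fun k : Fin 2 → ℝ => -K.eval k) (u • dir ϑ) (dir ϑ)) u := hasDerivAt_pertLevel_radius hdδ
  have h2 : HasDerivAt (fun s : ℝ => (fun k : Fin 2 → ℝ => sqDispersion k + (fun p : Fin 2 → ℝ => -K.eval p) k) (s • dir ϑ))
      (fderiv ℝ (fun k : Fin 2 → ℝ => sqDispersion k + (fun p : Fin 2 → ℝ => -K.eval p) k) (u • dir ϑ) (dir ϑ)) u :=
    (hdiff _).hasFDerivAt.comp_hasDerivAt u (hasDerivAt_smul_dir ϑ u)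
  have hfun : (fun s : ℝ => rayDispersion (ϑ, s) + (fun k : Fin 2 → ℝ => -K.eval k) (s • dir ϑ)) =
      fun s : ℝ => (fun k : Fin 2 → ℝ => sqDispersion k + (fun p : Fin 2 → ℝ => -K.eval p) k) (s • dir ϑ) := by
    funext s'; rfl
  rw [hfun] at h1
  rw [h1.unique h2, levelPoint_eq_toLp_smul_dir, fderiv_frameLevel_toLp_apply_eq]

omit hA20 hr hA₃ hA₄ hA₅ hA₆ in
/-- **THE LEVEL VELOCITY OF THE CHART**: `∂_ρΦ(ρ,ϑ) = D(ρ,ϑ)⁻¹ • toLp(dir ϑ)` for `|ρ| < r`. -/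
theorem hasDerivAt_levelPoint_level_slope {ρ : ℝ} (hρ : |ρ| < r) (ϑ : ℝ) :
    HasDerivAt (fun x : ℝ => levelPoint μ K x ϑ)
      ((fderiv ℝ (frameLevel μ K) (levelPoint μ K ρ ϑ) (WithLp.toLp 2 (dir ϑ)))⁻¹ • (WithLp.toLp 2 (dir ϑ) : Momentum)) ρ := by
  set B₀ := bandBounds (show (-4 : ℝ) < -1.1 by norm_num) (show (-1.1 : ℝ) ≤ -0.1 by norm_num) (show (-0.1 : ℝ) < 0 by norm_num) with hB₀
  have hADt : 2 * A < B₀.Dtmin := by have := klCurveD_pos; linarith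
  have h := hasDerivAt_levelPoint_level B₀ hA hADt hlo hhi (ρ := ρ) ⟨(abs_lt.1 hρ).1, (abs_lt.1 hρ).2⟩ ϑ
  rwa [deriv_levelRadius_level_eq_inv_slope hA hd hlo hhi hρ ϑ, WithLp.toLp_smul] at h

omit hr in
/-- **Angular jets of the radial slope**: `|∂ˡ_ϑ D(ρ,·)(s)| ≤ (l+1)!·𝒦·𝒟ˡ` whenever `‖Dᵐe_K‖ ≤ 𝒦` (`1 ≤ m ≤ l+1`), `1 ≤ 𝒟`, `msD6 j ≤ 𝒟ʲ` (`1 ≤ j ≤ l`),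
`l ≤ 5`, `|ρ| < r`. -/
theorem abs_iteratedDeriv_radialSlope_le {l : ℕ} (hl : l ≤ 5) {𝒦 𝒟 : ℝ}
    (hK : ∀ m, 1 ≤ m → m ≤ l + 1 → ∀ p : Momentum, ‖iteratedFDeriv ℝ m (frameLevel μ K) p‖ ≤ 𝒦) (h𝒟 : 1 ≤ 𝒟)
    (hD : ∀ j, 1 ≤ j → j ≤ l → msD6 A₃ A₄ A₅ A₆ j ≤ 𝒟 ^ j) {ρ : ℝ} (hρ : |ρ| < r) (s : ℝ) :
    |iteratedDeriv l (fun t : ℝ => fderiv ℝ (frameLevel μ K) (levelPoint μ K ρ t) (WithLp.toLp 2 (dir t))) s| ≤ (l + 1).factorial * 𝒦 * 𝒟 ^ l := by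
  have hshift := congrFun (iteratedDeriv_comp_const_add l (fun t : ℝ => fderiv ℝ (frameLevel μ K) (levelPoint μ K ρ t) (WithLp.toLp 2 (dir t))) s) 0
  rw [add_zero] at hshift
  rw [← hshift, ← Real.norm_eq_abs]
  have hY : ContDiff ℝ (l + 1 : ℕ) (fun t : ℝ => levelPoint μ K ρ (s + t)) :=
    (contDiff_levelPoint_of_sizes hA hd hlo hhi hρ (l + 1)).comp (contDiff_const.add contDiff_id)
  have hΔ : ContDiff ℝ (l + 1 : ℕ) (fun t : ℝ => (WithLp.toLp 2 (dir (s + t)) : Momentum)) := contDiff_toLp_dir.comp (contDiff_const.add contDiff_id)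
  have h := norm_iteratedDeriv_fderiv_comp_apply_le (EngineV8.contDiff_frameLevel μ K (n := (l + 1 : ℕ))) le_rfl hK hY hΔ (D := 𝒟) (R := 1)
    (le_trans zero_le_one h𝒟) zero_le_one
    (fun j hj1 hj => by
      have e := congrFun (iteratedDeriv_comp_const_add j (levelPoint μ K ρ) s) 0
      rw [add_zero] at e
      rw [e]
      exact (norm_iteratedDeriv_levelPoint_le_six hA hA20 hd hlo hhi hA₃ hA₄ hA₅ hA₆ hρ hj1 (by omega) s).trans (hD j hj1 hj))
    (fun j hj => by
      have e := congrFun (iteratedDeriv_comp_const_add j (fun t : ℝ => (WithLp.toLp 2 (dir t) : Momentum)) s) 0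
      rw [add_zero] at e
      rw [e, norm_iteratedDeriv_toLp_dir, one_mul]
      exact one_le_pow₀ h𝒟)
  simpa only [mul_one] using h

omit hr in
/-- **Angular jets of the reciprocal slope** `w = 1/D(ρ,·)`: `|w⁽ᵏ⁾(s)| ≤ Q k` (`k ≤ N ≤ 5`) for any table `Q` closing the reciprocal recursion
`d⁻¹ ≤ Q 0`, `d⁻¹·Σ_{j<k} C(k,j)·Q j·((k−j+1)!·𝒦·𝒟^{k−j}) ≤ Q k` (`d = Dt_min − 2A`). -/
theorem abs_iteratedDeriv_inv_radialSlope_le {N : ℕ} (hN : N ≤ 5) {𝒦 𝒟 : ℝ}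
    (hK : ∀ m, 1 ≤ m → m ≤ N + 1 → ∀ p : Momentum, ‖iteratedFDeriv ℝ m (frameLevel μ K) p‖ ≤ 𝒦) (h𝒟 : 1 ≤ 𝒟)
    (hD : ∀ j, 1 ≤ j → j ≤ N → msD6 A₃ A₄ A₅ A₆ j ≤ 𝒟 ^ j) {Q : ℕ → ℝ}
    (hQ0 : ((bandBounds (show (-4 : ℝ) < -1.1 by norm_num) (show (-1.1 : ℝ) ≤ -0.1 by norm_num) (show (-0.1 : ℝ) < 0 by norm_num)).Dtmin - 2 * A)⁻¹ ≤ Q 0)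
    (hQ : ∀ k, 1 ≤ k → k ≤ N → ((bandBounds (show (-4 : ℝ) < -1.1 by norm_num) (show (-1.1 : ℝ) ≤ -0.1 by norm_num)
        (show (-0.1 : ℝ) < 0 by norm_num)).Dtmin - 2 * A)⁻¹ *
        ∑ j ∈ Finset.range k, (k.choose j : ℝ) * Q j * ((k - j + 1).factorial * 𝒦 * 𝒟 ^ (k - j)) ≤ Q k)
    {ρ : ℝ} (hρ : |ρ| < r) {k : ℕ} (hk : k ≤ N) (s : ℝ) :
    |iteratedDeriv k (fun t : ℝ => (fderiv ℝ (frameLevel μ K) (levelPoint μ K ρ t) (WithLp.toLp 2 (dir t)))⁻¹) s| ≤ Q k := by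
  set B₀ := bandBounds (show (-4 : ℝ) < -1.1 by norm_num) (show (-1.1 : ℝ) ≤ -0.1 by norm_num) (show (-0.1 : ℝ) < 0 by norm_num) with hB₀
  set dd := B₀.Dtmin - 2 * A with hdd
  have hADt : 2 * A < B₀.Dtmin := by have := klCurveD_pos; linarith
  have hdpos : 0 < dd := by rw [hdd]; linarith
  have hY : ContDiff ℝ (N : ℕ) (levelPoint μ K ρ) := contDiff_levelPoint_of_sizes hA hd hlo hhi hρ N
  have hDf : ContDiff ℝ (N : ℕ) (fderiv ℝ (frameLevel μ K)) :=
    (EngineV8.contDiff_frameLevel μ K (n := (N + 1 : ℕ))).fderiv_right (by push_cast; exact le_rfl)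
  have hhc : ContDiff ℝ (N : ℕ) (fun t : ℝ => fderiv ℝ (frameLevel μ K) (levelPoint μ K ρ t) (WithLp.toLp 2 (dir t))) :=
    (hDf.comp hY).clm_apply contDiff_toLp_dir
  refine abs_iteratedDeriv_inv_le_of_table isOpen_univ hhc.contDiffOn hdpos (fun x _ => ?_)
    (Hb := fun l => (l + 1).factorial * 𝒦 * 𝒟 ^ l) (fun l hl1 hl x _ => ?_) hQ0 hQ k hk s (mem_univ s)
  · exact (radialSlope_levelPoint_ge hA hlo hhi hρ x).trans (le_abs_self _)
  · exact abs_iteratedDeriv_radialSlope_le hA hA20 hd hlo hhi hA₃ hA₄ hA₅ hA₆ (hl.trans hN)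
      (fun m hm1 hm p => hK m hm1 (by omega) p) h𝒟 (fun j hj1 hj => hD j hj1 (hj.trans hl)) hρ x

omit hr in
/-- **Angular jets of the level velocity**: `‖∂ⁱ_ϑ [D⁻¹ • toLp dir](s)‖ ≤ Σ_{j≤i} C(i,j)·Q j` (`i ≤ N`). -/
theorem norm_iteratedDeriv_levelVel_le {N : ℕ} (hN : N ≤ 5) {𝒦 𝒟 : ℝ}
    (hK : ∀ m, 1 ≤ m → m ≤ N + 1 → ∀ p : Momentum, ‖iteratedFDeriv ℝ m (frameLevel μ K) p‖ ≤ 𝒦) (h𝒟 : 1 ≤ 𝒟)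
    (hD : ∀ j, 1 ≤ j → j ≤ N → msD6 A₃ A₄ A₅ A₆ j ≤ 𝒟 ^ j) {Q : ℕ → ℝ}
    (hQ0 : ((bandBounds (show (-4 : ℝ) < -1.1 by norm_num) (show (-1.1 : ℝ) ≤ -0.1 by norm_num) (show (-0.1 : ℝ) < 0 by norm_num)).Dtmin - 2 * A)⁻¹ ≤ Q 0)
    (hQ : ∀ k, 1 ≤ k → k ≤ N → ((bandBounds (show (-4 : ℝ) < -1.1 by norm_num) (show (-1.1 : ℝ) ≤ -0.1 by norm_num)
        (show (-0.1 : ℝ) < 0 by norm_num)).Dtmin - 2 * A)⁻¹ *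
        ∑ j ∈ Finset.range k, (k.choose j : ℝ) * Q j * ((k - j + 1).factorial * 𝒦 * 𝒟 ^ (k - j)) ≤ Q k)
    {ρ : ℝ} (hρ : |ρ| < r) {i : ℕ} (hi : i ≤ N) (s : ℝ) :
    ‖iteratedDeriv i (fun t : ℝ => (fderiv ℝ (frameLevel μ K) (levelPoint μ K ρ t) (WithLp.toLp 2 (dir t)))⁻¹ • (WithLp.toLp 2 (dir t) : Momentum)) s‖ ≤
      ∑ j ∈ Finset.range (i + 1), (i.choose j : ℝ) * Q j := by
  have hiN : ((i : ℕ) : WithTop ℕ∞) ≤ (N : ℕ) := by exact_mod_cast hi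
  have hY : ContDiff ℝ (N : ℕ) (levelPoint μ K ρ) := contDiff_levelPoint_of_sizes hA hd hlo hhi hρ N
  have hDf : ContDiff ℝ (N : ℕ) (fderiv ℝ (frameLevel μ K)) :=
    (EngineV8.contDiff_frameLevel μ K (n := (N + 1 : ℕ))).fderiv_right (by push_cast; exact le_rfl)
  have hhc : ContDiff ℝ (N : ℕ) (fun t : ℝ => fderiv ℝ (frameLevel μ K) (levelPoint μ K ρ t) (WithLp.toLp 2 (dir t))) :=
    (hDf.comp hY).clm_apply contDiff_toLp_dir
  have hne : ∀ t : ℝ, fderiv ℝ (frameLevel μ K) (levelPoint μ K ρ t) (WithLp.toLp 2 (dir t)) ≠ 0 := fun t => by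
    have hADt : 2 * A < (bandBounds (show (-4 : ℝ) < -1.1 by norm_num) (show (-1.1 : ℝ) ≤ -0.1 by norm_num)
        (show (-0.1 : ℝ) < 0 by norm_num)).Dtmin := by have := klCurveD_pos; linarith
    have h := radialSlope_levelPoint_ge hA hlo hhi hρ t
    intro h0; rw [h0] at h; linarith
  have hw : ContDiff ℝ (N : ℕ) (fun t : ℝ => (fderiv ℝ (frameLevel μ K) (levelPoint μ K ρ t) (WithLp.toLp 2 (dir t)))⁻¹) := hhc.inv hne
  rw [← norm_iteratedFDeriv_eq_norm_iteratedDeriv]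
  refine (norm_iteratedFDeriv_smul_le hw contDiff_toLp_dir s hiN).trans (Finset.sum_le_sum fun j hj => ?_)
  have hji : j ≤ i := Nat.lt_succ_iff.1 (Finset.mem_range.1 hj)
  rw [norm_iteratedFDeriv_eq_norm_iteratedDeriv, norm_iteratedFDeriv_eq_norm_iteratedDeriv, norm_iteratedDeriv_toLp_dir, mul_one, Real.norm_eq_abs]
  exact mul_le_mul_of_nonneg_left (abs_iteratedDeriv_inv_radialSlope_le hA hA20 hd hlo hhi hA₃ hA₄ hA₅ hA₆ hN hK h𝒟 hD hQ0 hQ hρ (hji.trans hi) s)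
    (Nat.cast_nonneg _)

/-! ## §3 The radial rows at every order `i ≤ 5` -/

omit hr in
/-- **RADIAL ROWS AT EVERY ORDER.**  For `N ≤ 5`, band rows `‖Dᵐe_K‖ ≤ 𝒦` (`1 ≤ m ≤ N+1`), a curve base `𝒟 ≥ 1` with `msD6 j ≤ 𝒟ʲ` (`1 ≤ j ≤ N`),
and a reciprocal table `Q` (`d⁻¹ ≤ Q 0`, `d⁻¹·Σ_{j<k} C(k,j)·Q j·((k−j+1)!·𝒦·𝒟^{k−j}) ≤ Q k`, `d = Dt_min − 2A`):
`‖Φ_x⁽ⁱ⁾(s) − Φ_0⁽ⁱ⁾(s)‖ ≤ (Σ_{j≤i} C(i,j)·Q j)·|x|` for every `i ≤ N`, `|x| < r`, `s`.  [cite: BenfattoGiulianiMastropietro2006, §2.4 Lemma 2.1 (2.40)–(2.41)] -/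
theorem norm_iteratedDeriv_levelPoint_sub_le_of_table {N : ℕ} (hN : N ≤ 5) {𝒦 𝒟 : ℝ}
    (hK : ∀ m, 1 ≤ m → m ≤ N + 1 → ∀ p : Momentum, ‖iteratedFDeriv ℝ m (frameLevel μ K) p‖ ≤ 𝒦) (h𝒟 : 1 ≤ 𝒟)
    (hD : ∀ j, 1 ≤ j → j ≤ N → msD6 A₃ A₄ A₅ A₆ j ≤ 𝒟 ^ j) {Q : ℕ → ℝ}
    (hQ0 : ((bandBounds (show (-4 : ℝ) < -1.1 by norm_num) (show (-1.1 : ℝ) ≤ -0.1 by norm_num) (show (-0.1 : ℝ) < 0 by norm_num)).Dtmin - 2 * A)⁻¹ ≤ Q 0)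
    (hQ : ∀ k, 1 ≤ k → k ≤ N → ((bandBounds (show (-4 : ℝ) < -1.1 by norm_num) (show (-1.1 : ℝ) ≤ -0.1 by norm_num)
        (show (-0.1 : ℝ) < 0 by norm_num)).Dtmin - 2 * A)⁻¹ *
        ∑ j ∈ Finset.range k, (k.choose j : ℝ) * Q j * ((k - j + 1).factorial * 𝒦 * 𝒟 ^ (k - j)) ≤ Q k)
    {x : ℝ} (hx : |x| < r) {i : ℕ} (hi : i ≤ N) (s : ℝ) :
    ‖iteratedDeriv i (levelPoint μ K x) s - iteratedDeriv i (levelPoint μ K 0) s‖ ≤ (∑ j ∈ Finset.range (i + 1), (i.choose j : ℝ) * Q j) * |x| := by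
  set B₀ := bandBounds (show (-4 : ℝ) < -1.1 by norm_num) (show (-1.1 : ℝ) ≤ -0.1 by norm_num) (show (-0.1 : ℝ) < 0 by norm_num) with hB₀
  have hADt : 2 * A < B₀.Dtmin := by have := klCurveD_pos; linarith
  refine norm_iteratedDeriv_sub_le_of_strip (Ψ := fun ρ ϑ => levelPoint μ K ρ ϑ)
    (V := fun ρ ϑ => (fderiv ℝ (frameLevel μ K) (levelPoint μ K ρ ϑ) (WithLp.toLp 2 (dir ϑ)))⁻¹ • (WithLp.toLp 2 (dir ϑ) : Momentum))
    (r := r) (fun p hp => ?_) (fun ρ hρ ϑ => hasDerivAt_levelPoint_level_slope hA hd hlo hhi hρ ϑ) s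
    (fun ρ hρ => norm_iteratedDeriv_levelVel_le hA hA20 hd hlo hhi hA₃ hA₄ hA₅ hA₆ hN hK h𝒟 hD hQ0 hQ hρ hi s) hx
  have h1 : (-1.1 : ℝ) < μ + p.1 - A := by have := (abs_lt.1 hp).1; linarith
  have h2 : μ + p.1 + A < -0.1 := by have := (abs_lt.1 hp).2; linarith
  exact (contDiffAt_levelPoint B₀ hA hADt h1 h2 (m := ((i + 1 : ℕ) : ℕ∞)) p.2)

end Sizes

end Summit.HubbardSuperconductivity.HubbardSuperconductivity.Theorems.C4a

end
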